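import Literature.MathematicalPhysics.QuantumLattice.TorusBandWeylLaw
import HarnessLib

/-!
# The integrated density of states of the square-lattice band is monotone and continuous

Topic `MathematicalPhysics/QuantumLattice`. For the band function `-2(cos 2πv₁ + cos 2πv₂)` on the
unit cell `[0,1)²` (the limit object of the Weyl law `TorusBandWeylLaw.tendsto_torusLevelCount_div_sq`)
we PROVE that the integrated density of states
`E ↦ vol {v ∈ [0,1)² | -2(cos 2πv₁ + cos 2πv₂) ≤ E}` is monotone (`volume_real_sublevelCell_mono`)
and CONTINUOUS (`continuous_volume_real_sublevelCell`): the sublevel and strict sublevel cells have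
the same volume because level sets are null (`volume_sublevelCell_eq_strict`), so the monotone set
limits from the right (`tendsto_volume_sublevelCell_right`, continuity of measure from above) and
from the left (`tendsto_volume_sublevelCell_left`, from below) both recover the value at `E`.
No definition is introduced (explicit volumes throughout). [folklore]
-/

noncomputable section

open MeasureTheory Submodule Filter Topology Bornology Finset
open Literature.Probability.LatticeModels
open scoped Pointwise

namespace Literature.MathematicalPhysics.QuantumLattice
/-! ### The integrated density of states of the band: monotonicity and continuity -/

section IDS

/-- The unit cell has volume one. [folklore] -/
theorem volume_unitCell : volume {v : Fin 2 → ℝ | ∀ i, v i ∈ Set.Ico (0 : ℝ) 1} = 1 := by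
  rw [unitCell_eq_pi, volume_pi, Measure.pi_pi]
  simp

/-- Sublevel cells are contained in the unit cell. [folklore] -/
theorem sublevelCell_subset (E : ℝ) :
    {v : Fin 2 → ℝ | (∀ i, v i ∈ Set.Ico (0 : ℝ) 1) ∧
        -2 * ∑ i : Fin 2, Real.cos (2 * Real.pi * v i) ≤ E} ⊆
      {v : Fin 2 → ℝ | ∀ i, v i ∈ Set.Ico (0 : ℝ) 1} := fun _ hv => hv.1

/-- Sublevel cells have volume at most one. [folklore] -/
theorem volume_sublevelCell_le_one (E : ℝ) :
    volume {v : Fin 2 → ℝ | (∀ i, v i ∈ Set.Ico (0 : ℝ) 1) ∧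
        -2 * ∑ i : Fin 2, Real.cos (2 * Real.pi * v i) ≤ E} ≤ 1 := by
  rw [← volume_unitCell]
  exact measure_mono (sublevelCell_subset E)

/-- Sublevel cells have finite volume. [folklore] -/
theorem volume_sublevelCell_ne_top (E : ℝ) :
    volume {v : Fin 2 → ℝ | (∀ i, v i ∈ Set.Ico (0 : ℝ) 1) ∧
        -2 * ∑ i : Fin 2, Real.cos (2 * Real.pi * v i) ≤ E} ≠ ⊤ :=
  ne_top_of_le_ne_top ENNReal.one_ne_top (volume_sublevelCell_le_one E)

/-- Sublevel cells are measurable. [folklore] -/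
theorem measurableSet_sublevelCell (E : ℝ) :
    MeasurableSet {v : Fin 2 → ℝ | (∀ i, v i ∈ Set.Ico (0 : ℝ) 1) ∧
        -2 * ∑ i : Fin 2, Real.cos (2 * Real.pi * v i) ≤ E} := by
  have hsplit : {v : Fin 2 → ℝ | (∀ i, v i ∈ Set.Ico (0 : ℝ) 1) ∧
      -2 * ∑ i : Fin 2, Real.cos (2 * Real.pi * v i) ≤ E} =
      {v : Fin 2 → ℝ | ∀ i, v i ∈ Set.Ico (0 : ℝ) 1} ∩
        {v | -2 * ∑ i : Fin 2, Real.cos (2 * Real.pi * v i) ≤ E} := by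
    ext v; simp
  rw [hsplit, unitCell_eq_pi]
  exact (MeasurableSet.univ_pi fun _ => measurableSet_Ico).inter
    (measurableSet_le continuous_unitCellBand.measurable measurable_const)

/-- **The integrated density of states is monotone in the energy.** [folklore] -/
theorem volume_real_sublevelCell_mono {E E' : ℝ} (h : E ≤ E') :
    volume.real {v : Fin 2 → ℝ | (∀ i, v i ∈ Set.Ico (0 : ℝ) 1) ∧
        -2 * ∑ i : Fin 2, Real.cos (2 * Real.pi * v i) ≤ E} ≤
      volume.real {v : Fin 2 → ℝ | (∀ i, v i ∈ Set.Ico (0 : ℝ) 1) ∧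
        -2 * ∑ i : Fin 2, Real.cos (2 * Real.pi * v i) ≤ E'} := by
  refine measureReal_mono (fun v hv => ⟨hv.1, hv.2.trans h⟩) (volume_sublevelCell_ne_top E')

/-- The sublevel cell and the STRICT sublevel cell have the same volume (the level set is null).
[folklore] -/
theorem volume_sublevelCell_eq_strict (E : ℝ) :
    volume {v : Fin 2 → ℝ | (∀ i, v i ∈ Set.Ico (0 : ℝ) 1) ∧
        -2 * ∑ i : Fin 2, Real.cos (2 * Real.pi * v i) ≤ E} =
      volume {v : Fin 2 → ℝ | (∀ i, v i ∈ Set.Ico (0 : ℝ) 1) ∧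
        -2 * ∑ i : Fin 2, Real.cos (2 * Real.pi * v i) < E} := by
  refine le_antisymm ?_ (measure_mono fun v hv => ⟨hv.1, hv.2.le⟩)
  have hsub : {v : Fin 2 → ℝ | (∀ i, v i ∈ Set.Ico (0 : ℝ) 1) ∧
        -2 * ∑ i : Fin 2, Real.cos (2 * Real.pi * v i) ≤ E} ⊆
      {v : Fin 2 → ℝ | (∀ i, v i ∈ Set.Ico (0 : ℝ) 1) ∧
        -2 * ∑ i : Fin 2, Real.cos (2 * Real.pi * v i) < E} ∪
      {v : Fin 2 → ℝ | -2 * ∑ i : Fin 2, Real.cos (2 * Real.pi * v i) = E} := by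
    intro v hv
    rcases hv.2.lt_or_eq with h | h
    · exact Or.inl ⟨hv.1, h⟩
    · exact Or.inr h
  calc _ ≤ volume ({v : Fin 2 → ℝ | (∀ i, v i ∈ Set.Ico (0 : ℝ) 1) ∧
          -2 * ∑ i : Fin 2, Real.cos (2 * Real.pi * v i) < E} ∪
        {v : Fin 2 → ℝ | -2 * ∑ i : Fin 2, Real.cos (2 * Real.pi * v i) = E}) := measure_mono hsub
    _ ≤ volume {v : Fin 2 → ℝ | (∀ i, v i ∈ Set.Ico (0 : ℝ) 1) ∧
          -2 * ∑ i : Fin 2, Real.cos (2 * Real.pi * v i) < E} +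
        volume {v : Fin 2 → ℝ | -2 * ∑ i : Fin 2, Real.cos (2 * Real.pi * v i) = E} :=
          measure_union_le _ _
    _ = _ := by rw [volume_unitCellBand_eq E, add_zero]

/-- Continuity from the right of the integrated density of states along `E + 1/(n+1)`. [folklore] -/
theorem tendsto_volume_sublevelCell_right (E : ℝ) :
    Tendsto (fun n : ℕ => volume {v : Fin 2 → ℝ | (∀ i, v i ∈ Set.Ico (0 : ℝ) 1) ∧
        -2 * ∑ i : Fin 2, Real.cos (2 * Real.pi * v i) ≤ E + 1 / ((n : ℝ) + 1)}) atTop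
      (𝓝 (volume {v : Fin 2 → ℝ | (∀ i, v i ∈ Set.Ico (0 : ℝ) 1) ∧
        -2 * ∑ i : Fin 2, Real.cos (2 * Real.pi * v i) ≤ E})) := by
  have hInter : {v : Fin 2 → ℝ | (∀ i, v i ∈ Set.Ico (0 : ℝ) 1) ∧
        -2 * ∑ i : Fin 2, Real.cos (2 * Real.pi * v i) ≤ E} =
      ⋂ n : ℕ, {v : Fin 2 → ℝ | (∀ i, v i ∈ Set.Ico (0 : ℝ) 1) ∧
        -2 * ∑ i : Fin 2, Real.cos (2 * Real.pi * v i) ≤ E + 1 / ((n : ℝ) + 1)} := by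
    ext v
    simp only [Set.mem_setOf_eq, Set.mem_iInter]
    constructor
    · intro hv n
      exact ⟨hv.1, hv.2.trans (le_add_of_nonneg_right (by positivity))⟩
    · intro hv
      refine ⟨(hv 0).1, ?_⟩
      refine le_of_forall_pos_lt_add fun ε hε => ?_
      obtain ⟨n, hn⟩ := exists_nat_one_div_lt hε
      have := (hv n).2
      linarith
  rw [hInter]
  refine tendsto_measure_iInter_atTop (fun n => (measurableSet_sublevelCell _).nullMeasurableSet)
    ?_ ⟨0, volume_sublevelCell_ne_top _⟩
  intro n m hnm v hv
  refine ⟨hv.1, hv.2.trans ?_⟩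
  have : (1 : ℝ) / ((m : ℝ) + 1) ≤ 1 / ((n : ℝ) + 1) :=
    one_div_le_one_div_of_le (by positivity) (by exact_mod_cast Nat.add_le_add_right hnm 1)
  linarith

/-- Continuity from the left of the integrated density of states along `E - 1/(n+1)` (the limit is
the volume of the strict sublevel cell, equal to that of the sublevel cell). [folklore] -/
theorem tendsto_volume_sublevelCell_left (E : ℝ) :
    Tendsto (fun n : ℕ => volume {v : Fin 2 → ℝ | (∀ i, v i ∈ Set.Ico (0 : ℝ) 1) ∧
        -2 * ∑ i : Fin 2, Real.cos (2 * Real.pi * v i) ≤ E - 1 / ((n : ℝ) + 1)}) atTop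
      (𝓝 (volume {v : Fin 2 → ℝ | (∀ i, v i ∈ Set.Ico (0 : ℝ) 1) ∧
        -2 * ∑ i : Fin 2, Real.cos (2 * Real.pi * v i) ≤ E})) := by
  have hUnion : {v : Fin 2 → ℝ | (∀ i, v i ∈ Set.Ico (0 : ℝ) 1) ∧
        -2 * ∑ i : Fin 2, Real.cos (2 * Real.pi * v i) < E} =
      ⋃ n : ℕ, {v : Fin 2 → ℝ | (∀ i, v i ∈ Set.Ico (0 : ℝ) 1) ∧
        -2 * ∑ i : Fin 2, Real.cos (2 * Real.pi * v i) ≤ E - 1 / ((n : ℝ) + 1)} := by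
    ext v
    simp only [Set.mem_setOf_eq, Set.mem_iUnion]
    constructor
    · intro hv
      obtain ⟨n, hn⟩ := exists_nat_one_div_lt (sub_pos.2 hv.2)
      exact ⟨n, hv.1, by linarith⟩
    · rintro ⟨n, hv1, hv2⟩
      refine ⟨hv1, lt_of_le_of_lt hv2 ?_⟩
      have : (0 : ℝ) < 1 / ((n : ℝ) + 1) := by positivity
      linarith
  rw [volume_sublevelCell_eq_strict, hUnion]
  refine tendsto_measure_iUnion_atTop ?_
  intro n m hnm v hv
  refine ⟨hv.1, hv.2.trans ?_⟩
  have : (1 : ℝ) / ((m : ℝ) + 1) ≤ 1 / ((n : ℝ) + 1) :=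
    one_div_le_one_div_of_le (by positivity) (by exact_mod_cast Nat.add_le_add_right hnm 1)
  linarith

/-- **The integrated density of states of the square-lattice band is continuous** (no energy level
carries positive measure). [folklore] -/
theorem continuous_volume_real_sublevelCell :
    Continuous (fun E : ℝ => volume.real {v : Fin 2 → ℝ | (∀ i, v i ∈ Set.Ico (0 : ℝ) 1) ∧
        -2 * ∑ i : Fin 2, Real.cos (2 * Real.pi * v i) ≤ E}) := by
  refine continuous_iff_continuousAt.2 fun E => ?_
  rw [Metric.continuousAt_iff]
  intro ε hε
  -- the two one-sided sequential limits, in `ℝ`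
  have hR := ((ENNReal.tendsto_toReal (volume_sublevelCell_ne_top E)).comp
    (tendsto_volume_sublevelCell_right E))
  have hL := ((ENNReal.tendsto_toReal (volume_sublevelCell_ne_top E)).comp
    (tendsto_volume_sublevelCell_left E))
  rw [Metric.tendsto_atTop] at hR hL
  obtain ⟨N₁, hN₁⟩ := hR ε hε
  obtain ⟨N₂, hN₂⟩ := hL ε hε
  set N := max N₁ N₂ with hN
  refine ⟨1 / ((N : ℝ) + 1), by positivity, fun E' hE' => ?_⟩
  have h1 := hN₁ N (le_max_left _ _)
  have h2 := hN₂ N (le_max_right _ _)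
  simp only [Function.comp_apply] at h1 h2
  rw [Real.dist_eq] at hE' h1 h2 ⊢
  rw [← measureReal_def, ← measureReal_def] at h1
  rw [← measureReal_def, ← measureReal_def] at h2
  rw [abs_lt] at hE' h1 h2 ⊢
  rcases le_or_gt E E' with hle | hlt
  · have hup : E' ≤ E + 1 / ((N : ℝ) + 1) := by linarith [hE'.2]
    have m1 := volume_real_sublevelCell_mono hle
    have m2 := volume_real_sublevelCell_mono hup
    constructor <;> linarith [h1.2]
  · have hlo : E - 1 / ((N : ℝ) + 1) ≤ E' := by linarith [hE'.1]
    have m1 := volume_real_sublevelCell_mono hlt.le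
    have m2 := volume_real_sublevelCell_mono hlo
    constructor <;> linarith [h2.1]

end IDS



end Literature.MathematicalPhysics.QuantumLattice
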